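import Summits.QuantumFields.YangMills.Theorems.FluctuationComparisonRegPrIntLS2BetaWhitneyHatWeights
import Summits.QuantumFields.YangMills.Theorems.ConvexGribovBodyStrongCouplingShapeGeometry
import HarnessLib

/-!
# S2β · THE SUP CHAIN (UV3-NODE §94), HAZARD «READ-NEST» — THE READ′ NESTING LEMMA UNDER THE HAT LIFT:
# `⌊·∕L⌋` is 1-Lipschitz up to rounding on the torus, hat-lift feeders sit at most ONE coarse site from the block of the fine bond,
# hence a `θ = 2`-thick fine bond has all its feeders `θ = 2`-thick one level up (every `L ≥ 2`)

Cell `ym3-torus` (YM ladder rung R3 = continuum `SU(2)` Yang–Mills on the three-torus at fixed lattice data — a RUNG: NOT d = 4, NOT infinite volume,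
NOT a mass gap, NOT Clay).  Width seat «width 10» `ym3-torus-px10` (gen 25), FREE px helper on crux `stmt-QuantumFields-20520`
(`…Theses.UnitScaleTilt.FluctuationComparisonRegPrIntL`), LINE g18-1 S2β; `--kind proof --supports stmt-QuantumFields-20520 --as helper`, count-neutral,
DEFINITION-FREE (0 `def`, 0 `instance`, 0 `notation`, 0 `sorry`, default heartbeats).  ★★OWNER RULING №107 (2026-08-31 18:06:36Z): GO.

WHY (bus LOCATE px10 g25 18:05:34Z, booked HAZARD «READ-NEST»).  The lift-recursion knit ✓`…S2BetaSupTowerOfLiftLadder` (FILE 3) abstracts the (ST) summands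
`E(t) = Σ_B ‖η⁽ᴶ⁺ᵗ⁺¹⁾|_{READ_t(B)}‖²_∞` and asks its suppliers for `hREC : E(t+1) ≤ A·E(t) + c(t+1)` with `A·L ≤ ½`.  The `A·E(t)` row bounds a COMB bond `ℓ′` of
`READ_{t+1}(B)` by its HAT-LIFT FEEDERS `e` (✓`hatW_support`: `e ∥ ℓ′`, `0 ≤ (ℓ′.src − centre(e.src))_dir < L`, `|(…)_ν| < L`), and `READ_t(B)` as cut
(«source under the two top blocks of `B`», the same region at every level) does NOT contain the feeders of its boundary bonds — per-`B` nesting fails,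
and summing over `B` costs a top-lattice neighbour multiplicity that puts `A·L` above `½`.  The cure on the table thickens the read set AT EACH LEVEL's OWN
SCALE: `READ′_t(B)` = level-`(J+t+1)` bonds whose source is within `rel`-distance `2` (every coordinate, least-absolute-value representative) of a site
blocking into the two top blocks.  THIS FILE is the lattice lemma that makes `READ′` nest under the hat lift, for EVERY `B` separately and every `L ≥ 2`
(`2` is the least fixed point of `θ ≥ ⌈θ∕L⌉ + 1`; `θ = 1` does not nest).  It is pure torus combinatorics in ONE `Params` at levels `t + 1 → t`
(standing range `t + 1 ≤ m + K`), in the currency of ✓`hatW_support` (`rel`, `emb`, `blockOf`); the `blockIter`-indexed corollary in FILE 3's binder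
shape follows by `blockIter (t+1) = blockOf ∘ blockIter t` (lit ✓`B14Eq22Determines.blockIter_succ`) once the architect fixes the `READ′` text.

WHAT IS PROVED (sorry-free).
§1 The circle (over the tree's ✓`StrongCouplingShape.natAbs_valMinAbs_intCast_le`, imported, not restated):
   `natAbs_rel_le_add` (coordinatewise triangle inequality for `rel`), `natAbs_rel_comm` (symmetry), and
   ★★`natAbs_rel_blockOf_le_one` — **`|rel z x|_ν ≤ L ⟹ |rel (blockOf z) (blockOf x)|_ν ≤ 1`**: integer division by `L` is 1-Lipschitz up to rounding,
   WITH the torus wrap-around (the period of `T^{(t)}` is `L` times that of `T^{(t+1)}`, so the wrap contributes a multiple of the coarse period).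
§2 ★★`natAbs_rel_src_blockOf_le_one` — **a hat-lift feeder `e` of the fine bond `b` (`w b e ≠ 0`, weights pinned by the displayed formula `hw` of
   ✓`…WhitneyHatWeights`) has `|rel e.src (blockOf b.src)|_ν ≤ 1` for every `ν`** (§1 at distance `< L` from the centre `emb e.src`, and `blockOf ∘ emb = id`).
§3 ★★★`natAbs_rel_blockOf_src_le_two` — **THE NESTING STEP: if `b.src` is within `2` of `z` (every coordinate) and `w b e ≠ 0`, then `e.src` is within `2`
   of `blockOf z`**; ★★`natAbs_rel_blockOf_src_le_two_of_le` — the same from ANY fine distance `≤ L` in the coordinate at hand (so the transverse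
   PARTNER `b + e_ι` of a `θ = 2`-thick bond, which is `3 ≤ L`-thick, also has `θ = 2`-thick feeders: the `V`-row's pairs nest with NO extra thickening —
   px21 g24's remark); ★`natAbs_rel_blockOf_src_le_two_of_blockOf_eq` — the same for the feeders of any bond `r` of the SAME BLOCK as `b` (the rails of a
   rung's ladder are tree-comb bonds of the rung's own block, so the ladder row needs no extra thickening).
So with `z` a level-`(J+t+1)` witness of `ℓ′ ∈ READ′_{t+1}(B)` (`blockIter (t+1) z ∈ {B′.src, B′.tgt}`), `blockOf z` witnesses `e ∈ READ′_t(B)` for every feeder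
`e` of `ℓ′` and of its rails: `feeders(READ′_{t+1}(B)) ⊆ READ′_t(B)`, per `B`, K-uniformly (the thickening is `2` sites of the level's own lattice, i.e.
`2L^{−(t+1)}` top units, summable over the tower).

HONEST SCOPE.  Finite torus arithmetic (`ZMod.valMinAbs`, `⌊·∕L⌋`); no group, no field, no analysis; nothing of Bałaban's renormalisation-group analysis is
asserted or proved ([Balaban1985RegularSpaces] (1.29) p.81 and [Balaban1984PropagatorsI] (1.7) p.18 are the printed loci of the interpolation whose support this
bookkeeping tracks; [Balaban1985Averaging] Prop. 4 (128)–(135) p.37–38 is the printed sup recursion the READ sets serve).  `READ′` is a PROPOSED re-cut, not yet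
the letter of record; (TOP-LAD), (LIFT-LAD), (SCT-c), (ST), LOC, AVG₂♭-ax_q, (D-ax), h3 remain HYPOTHESES; GAP♯∘ (`stub_uniformFibreGapOrbit`, registry 3732b7df
UNTOUCHED), S2β, the five registered stubs (0∕5), crux 20520, 19936, 19200 and `YM3TorusSU2` are NOT proved; no registered stub is closed; rung R3 = SU(2) YM₃ on
T³ — NOT d = 4, NOT infinite volume, NOT a mass gap, NOT Clay; the Yang–Mills mass gap is NOT proved.
-/

set_option autoImplicit false

namespace Summit.QuantumFields.YangMills.Theorems.FluctuationComparisonRegPrIntLS2BetaReadNesting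

open Finset
open Literature.MathematicalPhysics.QuantumFieldTheory.Balaban1983to89
open B10Eq27TorusAxialLog (rel rel_apply)
open Summit.QuantumFields.YangMills.Theorems.FluctuationComparisonRegPrIntLS2BetaWhitneyHatWeights (hatW_support)
open Summit.QuantumFields.YangMills.Theorems.StrongCouplingShape (natAbs_valMinAbs_intCast_le)

/-! ## §1 The circle: least-absolute-value representatives, and integer division by `L` on the torus -/

section Circle

-- `natAbs_valMinAbs_intCast_le` (the least-absolute-value representative of an integer's class is no larger than the integer) is REUSED from
-- ✓`…ConvexGribovBodyStrongCouplingShapeGeometry` (namespace `…Theorems.StrongCouplingShape`), not restated.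

variable {P : Params} {j : ℕ}

/-- Coordinatewise TRIANGLE INEQUALITY for relative positions on the torus: `|x − y|_ν ≤ |u − y|_ν + |x − u|_ν` (least-absolute-value
representatives; the representative of a sum is no larger than the sum of representatives). [folklore] -/
theorem natAbs_rel_le_add (y u x : Site P j) (ν : Fin P.d) :
    (rel y x ν).natAbs ≤ (rel y u ν).natAbs + (rel u x ν).natAbs := by
  have h : x ν - y ν = (((rel u x ν + rel y u ν : ℤ)) : ZMod (P.sitesPerDir j)) := by
    push_cast
    rw [rel_apply, rel_apply, ZMod.coe_valMinAbs, ZMod.coe_valMinAbs]; ring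
  rw [rel_apply y x, h]
  calc ((((rel u x ν + rel y u ν : ℤ)) : ZMod (P.sitesPerDir j)).valMinAbs).natAbs
      ≤ (rel u x ν + rel y u ν).natAbs := natAbs_valMinAbs_intCast_le _ _
    _ ≤ (rel u x ν).natAbs + (rel y u ν).natAbs := Int.natAbs_add_le _ _
    _ = (rel y u ν).natAbs + (rel u x ν).natAbs := add_comm _ _

/-- SYMMETRY: `|x − y|_ν = |y − x|_ν` for least-absolute-value representatives. [folklore] -/
theorem natAbs_rel_comm (y x : Site P j) (ν : Fin P.d) : (rel y x ν).natAbs = (rel x y ν).natAbs := by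
  rw [rel_apply, rel_apply, ← neg_sub (x ν) (y ν), ZMod.natAbs_valMinAbs_neg]

/-- ★★ **`⌊·∕L⌋` IS 1-LIPSCHITZ UP TO ROUNDING ON THE TORUS**: two sites of `T^{(j)}` at most `L` apart in coordinate `ν` (least-absolute-value
representative) block into sites of `T^{(j+1)}` at most `1` apart in coordinate `ν`.  Standing range `j + 1 ≤ m + K`: the period of `T^{(j)}` is
`L` times the period of `T^{(j+1)}`, so a wrap-around of the fine difference shifts the quotient by a whole number of coarse periods. [folklore] -/
theorem natAbs_rel_blockOf_le_one (hj : j + 1 ≤ P.m + P.K) (z x : Site P j) (ν : Fin P.d)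
    (h : (rel z x ν).natAbs ≤ P.L) : (rel (blockOf z) (blockOf x) ν).natAbs ≤ 1 := by
  have hN : P.sitesPerDir j = P.sitesPerDir (j + 1) * P.L := P.sitesPerDir_eq_mul_succ hj
  have hL0 : (0 : ℤ) < P.L := by exact_mod_cast P.L_pos
  -- the fine difference `δ` and the two labels `a`, `c`
  obtain ⟨hδ1, hδ2⟩ : -(P.L : ℤ) ≤ rel z x ν ∧ rel z x ν ≤ P.L := by
    have h' : |rel z x ν| ≤ (P.L : ℤ) := by rw [Int.abs_eq_natAbs]; exact_mod_cast h
    exact abs_le.mp h'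
  -- `x = z + δ` on the circle of `T^{(j)}`
  have hxz : x ν = z ν + ((rel z x ν : ℤ) : ZMod (P.sitesPerDir j)) := by
    rw [rel_apply, ZMod.coe_valMinAbs]; ring
  -- as integers: `a ≡ c + δ (mod N)`, hence `a = c + δ + N·q`
  have hmod : (((x ν).val : ℤ) : ZMod (P.sitesPerDir j)) = ((((z ν).val : ℤ) + rel z x ν : ℤ) : ZMod (P.sitesPerDir j)) := by
    push_cast
    rw [ZMod.natCast_zmod_val, ZMod.natCast_zmod_val, hxz]
  rw [ZMod.intCast_eq_intCast_iff] at hmod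
  obtain ⟨q, hq⟩ : ∃ q : ℤ, ((x ν).val : ℤ) = ((z ν).val : ℤ) + rel z x ν + (P.sitesPerDir j : ℤ) * q := by
    obtain ⟨k, hk⟩ := Int.modEq_iff_dvd.mp hmod
    exact ⟨-k, by rw [mul_neg]; linarith⟩
  -- the coarse labels are the integer quotients by `L`
  have hbx : (blockOf x) ν = ((((x ν).val : ℤ) / (P.L : ℤ) : ℤ) : ZMod (P.sitesPerDir (j + 1))) := by
    rw [← ZMod.natCast_zmod_val ((blockOf x) ν), Site.val_blockOf hj x ν, ← Int.natCast_div, Int.cast_natCast]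
  have hbz : (blockOf z) ν = ((((z ν).val : ℤ) / (P.L : ℤ) : ℤ) : ZMod (P.sitesPerDir (j + 1))) := by
    rw [← ZMod.natCast_zmod_val ((blockOf z) ν), Site.val_blockOf hj z ν, ← Int.natCast_div, Int.cast_natCast]
  -- dividing `a = c + δ + N′·L·q` by `L`
  have hdivx : ((x ν).val : ℤ) / (P.L : ℤ) = (((z ν).val : ℤ) + rel z x ν) / (P.L : ℤ) + (P.sitesPerDir (j + 1) : ℤ) * q := by
    have hNz : (P.sitesPerDir j : ℤ) = (P.sitesPerDir (j + 1) : ℤ) * (P.L : ℤ) := by exact_mod_cast hN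
    rw [hq, hNz]
    rw [show ((z ν).val : ℤ) + rel z x ν + (P.sitesPerDir (j + 1) : ℤ) * (P.L : ℤ) * q =
        (((z ν).val : ℤ) + rel z x ν) + ((P.sitesPerDir (j + 1) : ℤ) * q) * (P.L : ℤ) by ring,
      Int.add_mul_ediv_right _ _ hL0.ne']
  -- the coarse difference is the class of `r := ⌊(c+δ)∕L⌋ − ⌊c∕L⌋ ∈ {−1, 0, 1}`
  set A : ℤ := (((z ν).val : ℤ) + rel z x ν) / (P.L : ℤ) with hA
  set C : ℤ := ((z ν).val : ℤ) / (P.L : ℤ) with hC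
  have hdiff : (blockOf x) ν - (blockOf z) ν = (((A - C : ℤ)) : ZMod (P.sitesPerDir (j + 1))) := by
    rw [hbx, hbz, hdivx]; push_cast; rw [ZMod.natCast_self]; ring
  have hr1 : A ≤ C + 1 := by
    calc A ≤ (((z ν).val : ℤ) + 1 * (P.L : ℤ)) / (P.L : ℤ) := Int.ediv_le_ediv hL0 (by linarith)
      _ = C + 1 := Int.add_mul_ediv_right _ _ hL0.ne'
  have hr2 : C - 1 ≤ A := by
    calc C - 1 = (((z ν).val : ℤ) + (-1) * (P.L : ℤ)) / (P.L : ℤ) := by rw [Int.add_mul_ediv_right _ _ hL0.ne']; ring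
      _ ≤ A := Int.ediv_le_ediv hL0 (by linarith)
  rw [rel_apply, hdiff]
  calc (((A - C : ℤ) : ZMod (P.sitesPerDir (j + 1))).valMinAbs).natAbs ≤ (A - C).natAbs := natAbs_valMinAbs_intCast_le _ _
    _ ≤ 1 := by
        have h3 : ((A - C).natAbs : ℤ) ≤ 1 := by rw [Int.natCast_natAbs]; exact abs_le.mpr ⟨by linarith, by linarith⟩
        exact_mod_cast h3

end Circle

/-! ## §2 Hat-lift feeders sit at most one coarse site from the block of the fine bond -/

section Feeders

variable {P : Params} {t : ℕ}

/-- ★★ **FEEDER LOCALITY IN BLOCK CURRENCY**: if the coarse bond `e` feeds the fine bond `b` under the Whitney hat weights (`w b e ≠ 0`, weights pinned by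
the displayed formula `hw` of ✓`…WhitneyHatWeights`), then `e.src` is at most ONE site of `T^{(t+1)}` from `blockOf b.src` in every coordinate
(✓`hatW_support` puts `b.src` less than `L` fine sites from the centre `emb e.src`; §1 and `blockOf ∘ emb = id`). [cite: Balaban1985RegularSpaces, (1.29) p.81] -/
theorem natAbs_rel_src_blockOf_le_one (ht : t + 1 ≤ P.m + P.K) (w : PBond P t → PBond P (t + 1) → ℝ)
    (hw : ∀ b e, w b e = if e.dir = b.dir ∧ (b.src b.dir - emb e.src b.dir).val < P.L then
      ∏ ν ∈ Finset.univ.erase b.dir, max 0 (1 - ((rel (emb e.src) b.src ν).natAbs : ℝ) / P.L) else 0)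
    {b : PBond P t} {e : PBond P (t + 1)} (hbe : w b e ≠ 0) (ν : Fin P.d) :
    (rel e.src (blockOf b.src) ν).natAbs ≤ 1 := by
  obtain ⟨_, ⟨h0, hlt⟩, htr⟩ := hatW_support ht w hw hbe
  have hL : (rel (emb e.src) b.src ν).natAbs ≤ P.L := by
    by_cases hν : ν = b.dir
    · subst hν
      have h1 : ((rel (emb e.src) b.src b.dir).natAbs : ℤ) ≤ P.L := by rw [Int.natAbs_of_nonneg h0]; exact hlt.le
      exact_mod_cast h1
    · exact (htr ν hν).le
  have h := natAbs_rel_blockOf_le_one ht (emb e.src) b.src ν hL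
  rwa [Site.blockOf_emb ht] at h

end Feeders

/-! ## §3 The nesting step: `θ = 2`-thick fine bonds have `θ = 2`-thick feeders one level up -/

section Nesting

variable {P : Params} {t : ℕ}

/-- ★★★ **THE READ′ NESTING STEP UNDER THE HAT LIFT**: if the fine bond `b` has its source within `2` sites of `z` (every coordinate, least-absolute-value
representatives on `T^{(t)}`) and `e` feeds `b` (`w b e ≠ 0`), then `e.src` is within `2` sites of `blockOf z` on `T^{(t+1)}` — for every `L ≥ 2`
(here `L` is odd and `> 1`): `|rel (blockOf z) e.src|_ν ≤ |rel (blockOf z) (blockOf b.src)|_ν + |rel (blockOf b.src) e.src|_ν ≤ 1 + 1`.  With `z` a witness of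
`b ∈ READ′_{t+1}(B)`, `blockOf z` witnesses `e ∈ READ′_t(B)`: the thickened read sets NEST, per `B`. [cite: Balaban1985RegularSpaces, (1.29) p.81] -/
theorem natAbs_rel_blockOf_src_le_two (ht : t + 1 ≤ P.m + P.K) (w : PBond P t → PBond P (t + 1) → ℝ)
    (hw : ∀ b e, w b e = if e.dir = b.dir ∧ (b.src b.dir - emb e.src b.dir).val < P.L then
      ∏ ν ∈ Finset.univ.erase b.dir, max 0 (1 - ((rel (emb e.src) b.src ν).natAbs : ℝ) / P.L) else 0)
    {b : PBond P t} {e : PBond P (t + 1)} (hbe : w b e ≠ 0) {z : Site P t} (hz : ∀ ν, (rel z b.src ν).natAbs ≤ 2) (ν : Fin P.d) :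
    (rel (blockOf z) e.src ν).natAbs ≤ 2 := by
  have h2L : 2 ≤ P.L := by have := P.hL.2; omega
  have h1 : (rel (blockOf z) (blockOf b.src) ν).natAbs ≤ 1 := natAbs_rel_blockOf_le_one ht z b.src ν ((hz ν).trans h2L)
  have h2 : (rel (blockOf b.src) e.src ν).natAbs ≤ 1 := by
    rw [natAbs_rel_comm]; exact natAbs_rel_src_blockOf_le_one ht w hw hbe ν
  calc (rel (blockOf z) e.src ν).natAbs ≤ (rel (blockOf z) (blockOf b.src) ν).natAbs + (rel (blockOf b.src) e.src ν).natAbs :=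
        natAbs_rel_le_add _ _ _ _
    _ ≤ 2 := by omega

/-- ★★ **THE NESTING STEP FROM ANY FINE DISTANCE UP TO `L`** (px21 g24's remark for the `V`-row: a transverse PARTNER `b + e_ι` of a `θ = 2`-thick bond is
`θ = 3 ≤ L`-thick, and its feeders are still `θ = 2`-thick one level up): if `b.src` is within `L` fine sites of `z` in coordinate `ν` and `e` feeds `b`,
then `e.src` is within `2` coarse sites of `blockOf z` in coordinate `ν` — the `⌊·∕L⌋` lemma needs only `≤ L`. [cite: Balaban1985RegularSpaces, (1.29) p.81] -/
theorem natAbs_rel_blockOf_src_le_two_of_le (ht : t + 1 ≤ P.m + P.K) (w : PBond P t → PBond P (t + 1) → ℝ)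
    (hw : ∀ b e, w b e = if e.dir = b.dir ∧ (b.src b.dir - emb e.src b.dir).val < P.L then
      ∏ ν ∈ Finset.univ.erase b.dir, max 0 (1 - ((rel (emb e.src) b.src ν).natAbs : ℝ) / P.L) else 0)
    {b : PBond P t} {e : PBond P (t + 1)} (hbe : w b e ≠ 0) {z : Site P t} (ν : Fin P.d) (hz : (rel z b.src ν).natAbs ≤ P.L) :
    (rel (blockOf z) e.src ν).natAbs ≤ 2 := by
  have h1 : (rel (blockOf z) (blockOf b.src) ν).natAbs ≤ 1 := natAbs_rel_blockOf_le_one ht z b.src ν hz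
  have h2 : (rel (blockOf b.src) e.src ν).natAbs ≤ 1 := by
    rw [natAbs_rel_comm]; exact natAbs_rel_src_blockOf_le_one ht w hw hbe ν
  calc (rel (blockOf z) e.src ν).natAbs ≤ (rel (blockOf z) (blockOf b.src) ν).natAbs + (rel (blockOf b.src) e.src ν).natAbs :=
        natAbs_rel_le_add _ _ _ _
    _ ≤ 2 := by omega

/-- ★ **THE SAME FOR ANY BOND OF THE SAME BLOCK** (the rails of a rung's ladder are tree-comb bonds `r` with `blockOf r.src = blockOf b.src`; their feeders are
fed from within `2` of `blockOf z` as well — the ladder row of `hREC` needs no extra thickening). [cite: Balaban1985RegularSpaces, (1.29) p.81] -/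
theorem natAbs_rel_blockOf_src_le_two_of_blockOf_eq (ht : t + 1 ≤ P.m + P.K) (w : PBond P t → PBond P (t + 1) → ℝ)
    (hw : ∀ b e, w b e = if e.dir = b.dir ∧ (b.src b.dir - emb e.src b.dir).val < P.L then
      ∏ ν ∈ Finset.univ.erase b.dir, max 0 (1 - ((rel (emb e.src) b.src ν).natAbs : ℝ) / P.L) else 0)
    {b r : PBond P t} (hblk : blockOf r.src = blockOf b.src) {e : PBond P (t + 1)} (hre : w r e ≠ 0)
    {z : Site P t} (hz : ∀ ν, (rel z b.src ν).natAbs ≤ 2) (ν : Fin P.d) :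
    (rel (blockOf z) e.src ν).natAbs ≤ 2 := by
  have h2L : 2 ≤ P.L := by have := P.hL.2; omega
  have h1 : (rel (blockOf z) (blockOf b.src) ν).natAbs ≤ 1 := natAbs_rel_blockOf_le_one ht z b.src ν ((hz ν).trans h2L)
  have h2 : (rel (blockOf b.src) e.src ν).natAbs ≤ 1 := by
    rw [natAbs_rel_comm, ← hblk]; exact natAbs_rel_src_blockOf_le_one ht w hw hre ν
  calc (rel (blockOf z) e.src ν).natAbs ≤ (rel (blockOf z) (blockOf b.src) ν).natAbs + (rel (blockOf b.src) e.src ν).natAbs :=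
        natAbs_rel_le_add _ _ _ _
    _ ≤ 2 := by omega

end Nesting

end Summit.QuantumFields.YangMills.Theorems.FluctuationComparisonRegPrIntLS2BetaReadNesting
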